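import Literature.NumberTheory.EllipticCurves.SerreOpenImageOrdinaryInertiaProofs
import HarnessLib

/-!
# Serre's open image theorem over `ℚ`: the local input is only needed for large `ℓ`

Topic `NumberTheory/EllipticCurves`.  Theorems only (nothing is defined, no named fact).  The
assembly of J.-P. Serre, Invent. Math. 15 (1972), §4.2, Théorème 2 over `K = ℚ` in the tree
(`WeierstrassCurve.exists_forall_hasSurjectiveModNGaloisRep_of_inertia_shape`,
`SerreOpenImageAssemblyProofs`; `serre_open_image_of_reduction_shape`,
`SerreOpenImageOfLocalInputProofs`; `serre_open_image_of_supersingular_inertia_shape`,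
`SerreOpenImageOrdinaryInertiaProofs`) asks for Serre's local description (§1.11) of `E[ℓ]`
under the inertia groups at **every** prime `ℓ` of good reduction.  Serre's proof only ever uses
it at the (hypothetical) infinitely many exceptional primes `ℓ`, which are eventually larger than
any bound; this file records the corresponding sharper statements, in which the local input is
required only for the primes `ℓ ≥ N` beyond a bound `N = N(E)` depending on the curve:

* `WeierstrassCurve.exists_forall_hasSurjectiveModNGaloisRep_of_inertia_shape_from` — the
  assembly with the local input assumed for `ℓ ≥ N` only (same proof, the exceptional set `L`
  avoiding `ℓ < max 7 N`);
* `serre_open_image_of_inertia_shape_from`, `serre_open_image_of_reduction_shape_from` — the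
  reductions of `SerreOpenImageOfLocalInputProofs` with the bound;
* `serre_open_image_of_supersingular_inertia_shape_from` — **`serre_open_image` follows from the
  density fact `serre_supersingular_density_zero` and Serre's Prop. 12 c) (the image of inertia
  at a good supersingular prime `ℓ` is cyclic of order `ℓ² - 1`) for the primes `ℓ ≥ N(E)`
  only** (so e.g. only for odd `ℓ ≥ 7`), the ordinary primes being handled unconditionally by
  `exists_line_of_not_dvd_frobeniusTrace_of_mem_primesAbove`.

## References

* [Serre1972] J.-P. Serre, Invent. Math. 15 (1972) 259–331, §4.2 Théorème 2 and its proof;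
  §1.11 Prop. 11–12.
-/

noncomputable section

open scoped Classical NumberField
open IsDedekindDomain Field Matrix

namespace WeierstrassCurve

open Literature.NumberTheory.EllipticCurves Literature.NumberTheory.GaloisRepresentations
  Literature.NumberTheory.GaloisRepresentations.Serre1972 NumberField Rat.HeightOneSpectrum

variable (W : WeierstrassCurve ℚ) [W.IsElliptic] [W.IsGloballyMinimal]

/-- **Serre 1972, §4.2, Théorème 2 for a globally minimal `E/ℚ` — the local input needed only
for `ℓ ≥ N`.**  Same statement and proof as the tree's
`exists_forall_hasSurjectiveModNGaloisRep_of_inertia_shape` (the density `0` of the good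
supersingular primes and the §1.11 shape of `E[ℓ]` under inertia give the surjectivity of
`ρ̄_{E,ℓ}` for all large `ℓ`), except that the local hypothesis `hF` is only assumed for the
primes `ℓ ≥ N`: in Serre's argument it is invoked only at exceptional primes `ℓ`, of which there
would be infinitely many, and the exceptional set is cut down to `ℓ ≥ max 7 N`.
[cite: Serre1972, §4.2, Théorème 2] -/
theorem exists_forall_hasSurjectiveModNGaloisRep_of_inertia_shape_from
    (hSS : HasPrimeDensity W.goodSupersingularPrimes 0) (N : ℕ)
    (hF : ∀ (ℓ : ℕ) [Fact ℓ.Prime], N ≤ ℓ → W.HasGoodReductionAtPrime ℓ →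
      ∀ v : HeightOneSpectrum (𝓞 ℚ), (primesEquiv v : ℕ) = ℓ → ∀ 𝔏 ∈ v.primesAbove,
        (letI : Module (ZMod ℓ) (geomTorsion W ℓ) := AddSubgroup.torsionBy.zmodModule
         ∃ v₀ : geomTorsion W ℓ, v₀ ≠ 0 ∧
           (∀ τ ∈ 𝔏.inertia (absoluteGaloisGroup ℚ), ∀ x : geomTorsion W ℓ,
              ∃ b : ZMod ℓ, τ • x - x = b • v₀) ∧
           (∀ a : (ZMod ℓ)ˣ, ∃ τ ∈ 𝔏.inertia (absoluteGaloisGroup ℚ),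
              τ • v₀ = (a : ZMod ℓ) • v₀)) ∨
        (IsCyclic ((𝔏.inertia (absoluteGaloisGroup ℚ)).map (galoisRepTorsion W ℓ)) ∧
          Nat.card ((𝔏.inertia (absoluteGaloisGroup ℚ)).map (galoisRepTorsion W ℓ)) =
            ℓ ^ 2 - 1)) :
    ∃ p₀ : ℕ, ∀ p : ℕ, p.Prime → p₀ ≤ p → W.HasSurjectiveModNGaloisRep p := by
  by_contra hneg
  push Not at hneg
  -- the bad primes `s`, the exceptional set, and the infinite set `L` of exceptional `ℓ`
  have hbadfin := W.finite_setOf_prime_not_hasGoodReductionAtPrime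
  set s : Finset ℕ := hbadfin.toFinset with hsdef
  have hsprime : ∀ q ∈ s, q.Prime := by
    intro q hq
    obtain ⟨hq, -⟩ := hbadfin.mem_toFinset.mp hq
    exact hq.out
  have hs : ∀ (p : ℕ) [Fact p.Prime], p ∉ s → W.HasGoodReductionAtPrime p := by
    intro p hp hps
    by_contra h
    exact hps (hbadfin.mem_toFinset.mpr ⟨hp, h⟩)
  have hirrfin := finite_setOf_not_hasIrreducibleModPGaloisRep_rat W
  set L : Set ℕ := {ℓ | ℓ.Prime ∧ ¬ W.HasSurjectiveModNGaloisRep ℓ} \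
    ((Set.Iio (max 7 N) ∪ ↑s) ∪ {ℓ | ℓ.Prime ∧ ¬ W.HasIrreducibleModPGaloisRep ℓ}) with hLdef
  have hLinf : L.Infinite := by
    refine Set.Infinite.sdiff ?_ (((Set.finite_Iio _).union s.finite_toSet).union hirrfin)
    refine Set.infinite_of_forall_exists_gt fun a ↦ ?_
    obtain ⟨p, hp, hap, hns⟩ := hneg (a + 1)
    exact ⟨p, ⟨hp, hns⟩, by omega⟩
  -- for `ℓ ∈ L`: the quadratic subgroup `U_ℓ`
  have hLprop : ∀ ℓ ∈ L, ℓ.Prime ∧ ¬ W.HasSurjectiveModNGaloisRep ℓ ∧ max 7 N ≤ ℓ ∧ ℓ ∉ s ∧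
      W.HasIrreducibleModPGaloisRep ℓ := by
    rintro ℓ ⟨⟨hℓ, hns⟩, hnot⟩
    simp only [Set.mem_union, Set.mem_Iio, Finset.mem_coe, Set.mem_setOf_eq, not_or, not_lt,
      not_and, not_not] at hnot
    exact ⟨hℓ, hns, hnot.1.1, hnot.1.2, hnot.2 hℓ⟩
  set 𝒰 : Set (Subgroup (absoluteGaloisGroup ℚ)) := {U | IsOpen (U : Set (absoluteGaloisGroup ℚ)) ∧
      U.index = 2 ∧ ∀ (𝔓 : Ideal (absIntegers (𝓞 ℚ) ℚ)), 𝔓.IsMaximal →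
        (∀ q ∈ s, (q : absIntegers (𝓞 ℚ) ℚ) ∉ 𝔓) → 𝔓.inertia (absoluteGaloisGroup ℚ) ≤ U}
    with h𝒰def
  have h𝒰fin : 𝒰.Finite := finite_setOf_index_eq_two_inertia_le s hsprime
  have key : ∀ ℓ ∈ L, ∃ U ∈ 𝒰, ∀ (p : ℕ) [Fact p.Prime], p ≠ ℓ → W.HasGoodReductionAtPrime p →
      ∀ v : HeightOneSpectrum (𝓞 ℚ), (primesEquiv v : ℕ) = p →
      ∀ 𝔓 ∈ v.primesAbove, ∀ σ : absoluteGaloisGroup ℚ, IsArithFrobAt (𝓞 ℚ) σ 𝔓 → σ ∉ U →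
        (ℓ : ℤ) ∣ W.frobeniusTrace p := by
    intro ℓ hℓL
    obtain ⟨hℓ, hns, hℓ7N, hℓs, hirr⟩ := hLprop ℓ hℓL
    have hℓ7 : 7 ≤ ℓ := le_of_max_le_left hℓ7N
    have hℓN : N ≤ ℓ := le_of_max_le_right hℓ7N
    haveI := Fact.mk hℓ
    obtain ⟨U, hUo, hUi, hUI, hU3⟩ :=
      W.exists_quadraticSubgroup_of_not_hasSurjectiveModNGaloisRep s hs ℓ hℓ7
        (hF ℓ hℓN (hs ℓ hℓs)) hirr hns
    exact ⟨U, ⟨hUo, hUi, hUI⟩, hU3⟩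
  choose! Uof hUof𝒰 hUof3 using key
  -- pigeonhole: one `U ∈ 𝒰` serves an infinite `L' ⊆ L`
  obtain ⟨U₀, hU₀𝒰, hL'inf⟩ : ∃ U₀ ∈ 𝒰, {ℓ ∈ L | Uof ℓ = U₀}.Infinite := by
    haveI : Infinite L := hLinf.to_subtype
    haveI : Finite 𝒰 := h𝒰fin.to_subtype
    obtain ⟨⟨U₀, hU₀⟩, hinf⟩ := Finite.exists_infinite_fiber
      (fun ℓ : L ↦ (⟨Uof ℓ, hUof𝒰 ℓ ℓ.2⟩ : 𝒰))
    refine ⟨U₀, hU₀, ?_⟩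
    have hinj : Function.Injective (fun ℓ : ((fun ℓ : L ↦ (⟨Uof ℓ, hUof𝒰 ℓ ℓ.2⟩ : 𝒰)) ⁻¹'
        {⟨U₀, hU₀⟩}) ↦ (ℓ : ℕ)) := fun a b h ↦ Subtype.ext (Subtype.ext h)
    refine Set.infinite_of_injective_forall_mem hinj ?_
    rintro ⟨⟨ℓ, hℓL⟩, hℓ⟩
    have hℓ' : Uof ℓ = U₀ := by
      have := congrArg Subtype.val (Set.mem_singleton_iff.mp hℓ)
      exact this
    exact ⟨hℓL, hℓ'⟩
  obtain ⟨hU₀o, hU₀i, hU₀I⟩ := hU₀𝒰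
  -- Lemme 3: every good prime with a Frobenius outside `U₀` is supersingular
  refine false_of_frobenius_not_mem_subset_density_zero U₀ hU₀o hU₀i (↑s) s.finite_toSet
    (fun p hp hps v hv 𝔓 h𝔓 ↦ ?_) hSS (fun p hp hps v hv 𝔓 h𝔓 σ hσ hσU ↦ ?_)
  · haveI := HeightOneSpectrum.isMaximal_of_mem_primesAbove h𝔓
    refine hU₀I 𝔓 inferInstance fun q hq hmem ↦ ?_
    have hqp : q ≠ p := fun h ↦ hps (h ▸ hq)
    exact Rat.natCast_not_mem_of_mem_primesAbove_of_not_dvd h𝔓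
      (by rw [hv]; exact fun h ↦ hqp ((Nat.prime_dvd_prime_iff_eq hp (hsprime q hq)).mp h).symm)
      hmem
  · haveI := Fact.mk hp
    have hgood : W.HasGoodReductionAtPrime p := hs p hps
    refine ⟨Fact.mk hp, hgood, ?_⟩
    have hzero : W.frobeniusTrace p = 0 := by
      apply eq_zero_of_infinite_setOf_prime_dvd
      refine Set.Infinite.mono ?_ (hL'inf.sdiff (Set.finite_singleton p))
      rintro ℓ ⟨⟨hℓL, hℓU⟩, hℓp⟩
      have hℓp' : p ≠ ℓ := fun h ↦ hℓp (Set.mem_singleton_iff.mpr h.symm)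
      refine ⟨(hLprop ℓ hℓL).1, ?_⟩
      exact hUof3 ℓ hℓL p hℓp' hgood v hv 𝔓 h𝔓 σ hσ (hℓU ▸ hσU)
    rw [hzero]
    exact dvd_zero _

end WeierstrassCurve

namespace Literature.NumberTheory.EllipticCurves

open _root_.WeierstrassCurve Rat.HeightOneSpectrum Literature.NumberTheory.GaloisRepresentations

/-- **`serre_open_image` from the local input of §1.11 beyond a bound and the density fact**
(threshold form of `serre_open_image_of_inertia_shape`): it suffices to know, for every elliptic
curve over `ℚ` in global minimal form, the §1.11 shape of `E[ℓ]` under the inertia groups above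
`ℓ` (ordinary: a line `𝔽_ℓ v₀` with `τ x - x ∈ 𝔽_ℓ v₀` and `χ_X` onto; supersingular: cyclic
image of order `ℓ² - 1`) for the good primes `ℓ ≥ N(E)`.  Proof: global minimal model
(`hasGlobalMinimalModel_rat_holds`), the threshold assembly, transport along `E ≅ C • E`.
[cite: Serre1972, §4.2, Théorème 2] -/
theorem serre_open_image_of_inertia_shape_from (hD : serre_supersingular_density_zero)
    (hF : ∀ (W : WeierstrassCurve ℚ) [W.IsElliptic] [W.IsGloballyMinimal], ∃ N : ℕ,
      ∀ (ℓ : ℕ) [Fact ℓ.Prime], N ≤ ℓ → W.HasGoodReductionAtPrime ℓ →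
      ∀ v : HeightOneSpectrum (𝓞 ℚ), (primesEquiv v : ℕ) = ℓ → ∀ 𝔏 ∈ v.primesAbove,
        (letI : Module (ZMod ℓ) (geomTorsion W ℓ) := AddSubgroup.torsionBy.zmodModule
         ∃ v₀ : geomTorsion W ℓ, v₀ ≠ 0 ∧
           (∀ τ ∈ 𝔏.inertia (absoluteGaloisGroup ℚ), ∀ x : geomTorsion W ℓ,
              ∃ b : ZMod ℓ, τ • x - x = b • v₀) ∧
           (∀ a : (ZMod ℓ)ˣ, ∃ τ ∈ 𝔏.inertia (absoluteGaloisGroup ℚ),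
              τ • v₀ = (a : ZMod ℓ) • v₀)) ∨
        (IsCyclic ((𝔏.inertia (absoluteGaloisGroup ℚ)).map (galoisRepTorsion W ℓ)) ∧
          Nat.card ((𝔏.inertia (absoluteGaloisGroup ℚ)).map (galoisRepTorsion W ℓ)) =
            ℓ ^ 2 - 1)) :
    serre_open_image := by
  intro W _ hCM
  -- a global minimal model `C • W`
  obtain ⟨C, hC⟩ := hasGlobalMinimalModel_rat_holds W
  haveI := hC
  -- no CM is preserved
  have hCM' : ¬ (C • W).HasCM := fun h ↦ hCM
    (HasCM.of_variableChange_baseChange (W₁ := W) (W₂ := C • W)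
      (C.map (algebraMap ℚ (AlgebraicClosure ℚ))) (map_variableChange W C _) h)
  obtain ⟨N, hN⟩ := hF (C • W)
  obtain ⟨p₀, hp₀⟩ :=
    (C • W).exists_forall_hasSurjectiveModNGaloisRep_of_inertia_shape_from (hD (C • W) hCM') N
      (fun ℓ _ ↦ hN ℓ)
  refine ⟨p₀, fun p hp hle ↦ ?_⟩
  exact hasSurjectiveModNGaloisRep_of_isogeny_bijective (VariableChange.toIsogeny W C)
    ⟨VariableChange.toIsogeny_injective W C, VariableChange.toIsogeny_surjective W C⟩ p
    (hp₀ p hp hle)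

/-- **`serre_open_image` from the reduction shape of `E[ℓ]` beyond a bound and the density
fact** (threshold form of `serre_open_image_of_reduction_shape`; the surjectivity of `χ_X` in
the ordinary alternative is automatic, `exists_mem_inertia_smul_eq_of_sub_mem_line`).
[cite: Serre1972, §4.2, Théorème 2; §1.11, Prop. 11, Prop. 12] -/
theorem serre_open_image_of_reduction_shape_from (hD : serre_supersingular_density_zero)
    (hF : ∀ (W : WeierstrassCurve ℚ) [W.IsElliptic] [W.IsGloballyMinimal], ∃ N : ℕ,
      ∀ (ℓ : ℕ) [Fact ℓ.Prime], N ≤ ℓ → W.HasGoodReductionAtPrime ℓ →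
      ∀ v : HeightOneSpectrum (𝓞 ℚ), (primesEquiv v : ℕ) = ℓ → ∀ 𝔏 ∈ v.primesAbove,
        (letI : Module (ZMod ℓ) (geomTorsion W ℓ) := AddSubgroup.torsionBy.zmodModule
         ∃ v₀ : geomTorsion W ℓ, v₀ ≠ 0 ∧
           ∀ τ ∈ 𝔏.inertia (absoluteGaloisGroup ℚ), ∀ x : geomTorsion W ℓ,
              ∃ b : ZMod ℓ, τ • x - x = b • v₀) ∨
        (IsCyclic ((𝔏.inertia (absoluteGaloisGroup ℚ)).map (galoisRepTorsion W ℓ)) ∧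
          Nat.card ((𝔏.inertia (absoluteGaloisGroup ℚ)).map (galoisRepTorsion W ℓ)) =
            ℓ ^ 2 - 1)) :
    serre_open_image := by
  refine serre_open_image_of_inertia_shape_from hD fun W _ _ ↦ ?_
  obtain ⟨N, hN⟩ := hF W
  refine ⟨N, fun ℓ _ hNℓ hgood v hv 𝔏 h𝔏 ↦ ?_⟩
  rcases hN ℓ hNℓ hgood v hv 𝔏 h𝔏 with ⟨v₀, hv₀, hquot⟩ | h
  · exact Or.inl ⟨v₀, hv₀, hquot,
      fun a ↦ W.exists_mem_inertia_smul_eq_of_sub_mem_line ℓ hv h𝔏 hv₀ hquot a⟩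
  · exact Or.inr h

/-- **Serre's open image theorem over `ℚ` from the density fact and Prop. 12 c) at the large
supersingular primes.**  Assume (hD) `WeierstrassCurve.serre_supersingular_density_zero` and
(hS) for every elliptic curve `E/ℚ` in global minimal form a bound `N` such that for every prime
`ℓ ≥ N` of good supersingular reduction (`ℓ ∣ a_ℓ`) and every prime `𝔏` of `\bar ℤ` above `ℓ`
the image of the inertia group `I_𝔏` in `Aut(E[ℓ])` is cyclic of order `ℓ² - 1` (Serre 1972,
§1.11, Prop. 12 c), `e = 1`).  Then `serre_open_image` holds: for `E/ℚ` without complex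
multiplication `ρ̄_{E,ℓ}` is onto for all large `ℓ`.  The ordinary primes are handled
unconditionally (`exists_line_of_not_dvd_frobeniusTrace_of_mem_primesAbove`).
[cite: Serre1972, §4.2 Théorème 2; §1.11 Prop. 11–12] -/
theorem serre_open_image_of_supersingular_inertia_shape_from
    (hD : serre_supersingular_density_zero)
    (hS : ∀ (W : WeierstrassCurve ℚ) [W.IsElliptic] [W.IsGloballyMinimal], ∃ N : ℕ,
      ∀ (ℓ : ℕ) [Fact ℓ.Prime], N ≤ ℓ → W.HasGoodReductionAtPrime ℓ →
      (ℓ : ℤ) ∣ W.frobeniusTrace ℓ →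
      ∀ v : HeightOneSpectrum (𝓞 ℚ), (primesEquiv v : ℕ) = ℓ → ∀ 𝔏 ∈ v.primesAbove,
        IsCyclic ((𝔏.inertia (absoluteGaloisGroup ℚ)).map (galoisRepTorsion W ℓ)) ∧
          Nat.card ((𝔏.inertia (absoluteGaloisGroup ℚ)).map (galoisRepTorsion W ℓ)) =
            ℓ ^ 2 - 1) :
    serre_open_image := by
  refine serre_open_image_of_reduction_shape_from hD fun W _ _ ↦ ?_
  obtain ⟨N, hN⟩ := hS W
  refine ⟨N, fun ℓ _ hNℓ hgood v hv 𝔏 h𝔏 ↦ ?_⟩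
  by_cases hord : (ℓ : ℤ) ∣ W.frobeniusTrace ℓ
  · exact Or.inr (hN ℓ hNℓ hgood hord v hv 𝔏 h𝔏)
  · exact Or.inl (exists_line_of_not_dvd_frobeniusTrace_of_mem_primesAbove ℓ
      (W.not_dvd_minimalDiscriminantInt_of_hasGoodReductionAtPrime' ℓ hgood) hord hv h𝔏)

end Literature.NumberTheory.EllipticCurves
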